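import Summits.AnomalousDissipation.AnomalousDissipation.Theorems.MomentParityPathField
import Literature.Analysis.FluidPDE.CylindricalGenerator
import Literature.Analysis.FluidPDE.EnergySpaceTorusGalerkinProofs
import Literature.Analysis.FunctionSpaces.WeakCompactnessL1Proofs

/-!
# Crux `EnsembleRealization` (stmt-AnomalousDissipation-0215) — line `augmented-lift`,
# sub-stub M2a `stub_augLimit`, tools part (iii): the tested generator on `L²` and its
# cylindrical approximants

Supports stmt-AnomalousDissipation-0215 (sub-stub `stub_augLimit` of the reshaped stub
`stub_augmentedLaw`, line `augmented-lift`). Nothing here closes an item.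

The Ambrosio–Trevisan identification of the modewise drifts needs, for a smooth test mode `a`,
the tested Navier–Stokes generator `⟨F(U), a⟩ = (f, a) + ν (U, Δa) + ∫ (U ⊗ U) : ∇a` as a
norm-continuous functional of an `L²` CLASS `U` (not only of `U ∈ H`: the truncations used as
cylindrical approximants need not be solenoidal or mean free): continuity and quadratic growth
(`continuous_gen`, `exists_abs_gen_le`), the flux form on representatives (`gen_toLp_eq_flux`),
and the CYLINDRICAL APPROXIMANTS `c ↦ ⟨F(T_M c), a⟩` through the real trigonometric polynomial
`T_M c = Re ∑_{|k| ≤ M} c_k e_k` of a coefficient vector (`continuous_trigLp`: continuous in the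
product topology; `tendsto_trigLp_mFourierCoeff`: `T_M û → u` in `L²`; `norm_trigLp_sq_le`).
Main statement: `stub_augLimitDriftTools`.
-/

noncomputable section

set_option linter.dupNamespace false

open MeasureTheory Set Filter Topology Function Metric UnitAddTorus
open scoped BigOperators ENNReal InnerProductSpace RealInnerProductSpace

namespace Summit.AnomalousDissipation.AnomalousDissipation.Theorems.EnsembleRealization

open Literature.Analysis.FunctionSpaces Literature.Analysis.FunctionSpaces.Torus
open Literature.Analysis.FluidPDE Literature.Analysis.FluidPDE.Torus
open Summit.AnomalousDissipation.AnomalousDissipation.Theorems.MomentParity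

variable {ν : ℝ} {f a : UnitAddTorus (Fin 3) → EuclideanSpace ℝ (Fin 3)} {R : ℝ} {L : (Fin 3 → ℤ) → ℝ}

/-! ### The tested generator on `L²` -/

/-- On `H` the `L²` tested generator is `nsGeneratorPairing`. -/
theorem gen_coe (u : Torus.energySpace (Fin 3)) : ((∫ x, ⟪f x, a x⟫_ℝ) + ν * (∫ x, ⟪((((u : Lp (EuclideanSpace ℝ (Fin 3)) 2 (volume : Measure
      (UnitAddTorus (Fin 3))))) : Lp (EuclideanSpace ℝ (Fin 3)) 2 (volume : Measure (UnitAddTorus (Fin 3)))) : UnitAddTorus (Fin 3) → EuclideanSpace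
      ℝ (Fin 3)) x, laplacian a x⟫_ℝ) + inertialPairing (((u : Lp (EuclideanSpace ℝ (Fin 3)) 2 (volume : Measure (UnitAddTorus (Fin 3))))) : Lp
      (EuclideanSpace ℝ (Fin 3)) 2 (volume : Measure (UnitAddTorus (Fin 3)))) a) = nsGeneratorPairing ν f u a := rfl

/-- **The tested generator is norm-continuous on `L²`** for a smooth test mode (constant +
bounded linear + bounded quadratic form, `continuous_inertialPairing`). -/
theorem continuous_gen (ha : IsSmooth a) : Continuous fun U : Lp (EuclideanSpace ℝ (Fin 3)) 2 (volume : Measure (UnitAddTorus (Fin 3))) => ((∫ x, ⟪f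
      x, a x⟫_ℝ) + ν * (∫ x, ⟪(((U) : Lp (EuclideanSpace ℝ (Fin 3)) 2 (volume : Measure (UnitAddTorus (Fin 3)))) : UnitAddTorus (Fin 3) →
      EuclideanSpace ℝ (Fin 3)) x, laplacian a x⟫_ℝ) + inertialPairing ((U) : Lp (EuclideanSpace ℝ (Fin 3)) 2 (volume : Measure (UnitAddTorus (Fin
      3)))) a) := by
  have hΔ : MemLp (laplacian a) 2 volume := ha.laplacian.memLp 2
  have h1 : Continuous fun U : Lp (EuclideanSpace ℝ (Fin 3)) 2 (volume : Measure (UnitAddTorus (Fin 3))) =>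
      ∫ x, ⟪(U : UnitAddTorus (Fin 3) → EuclideanSpace ℝ (Fin 3)) x, laplacian a x⟫_ℝ := by
    have h : (fun U : Lp (EuclideanSpace ℝ (Fin 3)) 2 (volume : Measure (UnitAddTorus (Fin 3))) => ∫ x, ⟪(U : UnitAddTorus (Fin 3) → EuclideanSpace ℝ
          (Fin 3)) x, laplacian a x⟫_ℝ) =
        fun U : Lp (EuclideanSpace ℝ (Fin 3)) 2 (volume : Measure (UnitAddTorus (Fin 3))) => ⟪U, hΔ.toLp (laplacian a)⟫_ℝ := funext fun U =>
              pairing_eq_inner hΔ U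
    rw [h]
    exact continuous_id.inner continuous_const
  have h2 : Continuous fun U : Lp (EuclideanSpace ℝ (Fin 3)) 2 (volume : Measure (UnitAddTorus (Fin 3))) => inertialPairing U a := continuous_inertialPairing ha
  exact (continuous_const.add (continuous_const.mul h1)).add h2

/-- **Quadratic growth of the tested generator on `L²`**: `|⟨F(U), a⟩| ≤ K (1 + ‖U‖²)`. -/
theorem exists_abs_gen_le (ν : ℝ) (f : UnitAddTorus (Fin 3) → EuclideanSpace ℝ (Fin 3)) (ha : IsSmooth a) :
    ∃ K : ℝ, 0 ≤ K ∧ ∀ U : Lp (EuclideanSpace ℝ (Fin 3)) 2 (volume : Measure (UnitAddTorus (Fin 3))), |((∫ x, ⟪f x, a x⟫_ℝ) +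
      ν * (∫ x, ⟪(U : UnitAddTorus (Fin 3) → EuclideanSpace ℝ (Fin 3)) x, laplacian a x⟫_ℝ) +
      inertialPairing U a)| ≤ K * (1 + ‖U‖ ^ 2) := by
  -- adapted from `exists_abs_nsGeneratorPairing_le` (CylindricalGenerator), `H` replaced by `L²`
  obtain ⟨C, hC0, hC⟩ := exists_sum_norm_partialDeriv_le ha
  have hΔ : MemLp (laplacian a) 2 volume := ha.laplacian.memLp 2
  set A : ℝ := |∫ x, ⟪f x, a x⟫_ℝ| with hA
  set B : ℝ := ‖hΔ.toLp (laplacian a)‖ with hB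
  refine ⟨A + |ν| * B + C, by positivity, fun U => ?_⟩
  have hu1 : ‖U‖ ≤ 1 + ‖U‖ ^ 2 := by nlinarith [sq_nonneg (‖U‖ - 1), norm_nonneg U]
  have h2 : |ν * ∫ x, ⟪(U : UnitAddTorus (Fin 3) → EuclideanSpace ℝ (Fin 3)) x, laplacian a x⟫_ℝ| ≤
      |ν| * B * (1 + ‖U‖ ^ 2) := by
    rw [abs_mul, mul_assoc]
    refine mul_le_mul_of_nonneg_left ?_ (abs_nonneg ν)
    have h : |∫ x, ⟪(U : UnitAddTorus (Fin 3) → EuclideanSpace ℝ (Fin 3)) x, laplacian a x⟫_ℝ| ≤ ‖U‖ * B := by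
      have e : ∫ x, ⟪(U : UnitAddTorus (Fin 3) → EuclideanSpace ℝ (Fin 3)) x, laplacian a x⟫_ℝ =
          ⟪U, hΔ.toLp (laplacian a)⟫_ℝ := pairing_eq_inner hΔ U
      rw [e]
      exact abs_real_inner_le_norm _ _
    calc _ ≤ ‖U‖ * B := h
      _ ≤ (1 + ‖U‖ ^ 2) * B := mul_le_mul_of_nonneg_right hu1 (norm_nonneg _)
      _ = B * (1 + ‖U‖ ^ 2) := mul_comm _ _
  have h3 : |inertialPairing U a| ≤ C * (1 + ‖U‖ ^ 2) := by
    have h := (integrable_inner_fderiv_apply_coe ha hC U U).2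
    rw [inertialPairing]
    refine h.trans (mul_le_mul_of_nonneg_left ?_ hC0)
    nlinarith [sq_nonneg ‖U‖]
  have h1 : A ≤ A * (1 + ‖U‖ ^ 2) := le_mul_of_one_le_right (abs_nonneg _) (by nlinarith [sq_nonneg ‖U‖])
  calc _ ≤ |∫ x, ⟪f x, a x⟫_ℝ| +
        |ν * ∫ x, ⟪(U : UnitAddTorus (Fin 3) → EuclideanSpace ℝ (Fin 3)) x, laplacian a x⟫_ℝ| +
        |inertialPairing U a| := abs_add_three _ _ _
    _ ≤ A * (1 + ‖U‖ ^ 2) + |ν| * B * (1 + ‖U‖ ^ 2) + C * (1 + ‖U‖ ^ 2) := add_le_add_three h1 h2 h3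
    _ = (A + |ν| * B + C) * (1 + ‖U‖ ^ 2) := by ring

/-- **Tested generator = flux on representatives**: for `w ∈ L²`,
`⟨F([w]), a⟩ = ∫ (⟪w, (w·∇)a⟫ + ν ⟪w, Δa⟫ + ⟪f, a⟫)` (the integrand of the modewise identity). -/
theorem gen_toLp_eq_flux (hf : MemLp f 2 volume) (ha : IsSmooth a)
    {w : UnitAddTorus (Fin 3) → EuclideanSpace ℝ (Fin 3)} (hw : MemLp w 2 volume) :
    ((∫ x, ⟪f x, a x⟫_ℝ) + ν * (∫ x, ⟪(((hw.toLp w) : Lp (EuclideanSpace ℝ (Fin 3)) 2 (volume : Measure (UnitAddTorus (Fin 3)))) : UnitAddTorus (Fin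
          3) → EuclideanSpace ℝ (Fin 3)) x, laplacian a x⟫_ℝ) + inertialPairing ((hw.toLp w) : Lp (EuclideanSpace ℝ (Fin 3)) 2 (volume : Measure
          (UnitAddTorus (Fin 3)))) a) = ∫ x, (⟪w x, convect w a x⟫_ℝ + ν * ⟪w x, laplacian a x⟫_ℝ + ⟪f x, a x⟫_ℝ) := by
  -- adapted from `nsGeneratorPairing_eq_flux` (CylindricalGenerator), `H` replaced by `L²`
  have hw' : ((hw.toLp w : Lp (EuclideanSpace ℝ (Fin 3)) 2 (volume : Measure (UnitAddTorus (Fin 3)))) : UnitAddTorus (Fin 3) → EuclideanSpace ℝ (Fin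
        3)) =ᵐ[volume] w := hw.coeFn_toLp
  have hi1 : Integrable (fun x => ⟪w x, convect w a x⟫_ℝ) volume := integrable_inner_convect_self hw ha
  have hi2 : Integrable (fun x => ν * ⟪w x, laplacian a x⟫_ℝ) volume :=
    (integrable_inner_of_continuous (hw.integrable one_le_two) ha.laplacian.continuous).const_mul ν
  have hi3 : Integrable (fun x => ⟪f x, a x⟫_ℝ) volume :=
    integrable_inner_of_continuous (hf.integrable one_le_two) ha.continuous
  have hi12 : Integrable (fun x => ⟪w x, convect w a x⟫_ℝ + ν * ⟪w x, laplacian a x⟫_ℝ) volume := hi1.add hi2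
  rw [integral_add hi12 hi3, integral_add hi1 hi2, integral_const_mul]
  unfold inertialPairing
  have e2 : ∫ x, ⟪((hw.toLp w : Lp (EuclideanSpace ℝ (Fin 3)) 2 (volume : Measure (UnitAddTorus (Fin 3)))) : UnitAddTorus (Fin 3) → EuclideanSpace ℝ
        (Fin 3)) x, laplacian a x⟫_ℝ =
      ∫ x, ⟪w x, laplacian a x⟫_ℝ := integral_congr_ae (hw'.mono fun x hx => by simp only [hx])
  have e3 : ∫ x, ⟪Torus.fderiv a x (((hw.toLp w : Lp (EuclideanSpace ℝ (Fin 3)) 2 (volume : Measure (UnitAddTorus (Fin 3)))) : UnitAddTorus (Fin 3) →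
        EuclideanSpace ℝ (Fin 3)) x),
      ((hw.toLp w : Lp (EuclideanSpace ℝ (Fin 3)) 2 (volume : Measure (UnitAddTorus (Fin 3)))) : UnitAddTorus (Fin 3) → EuclideanSpace ℝ (Fin 3)) x⟫_ℝ =
      ∫ x, ⟪w x, convect w a x⟫_ℝ :=
    integral_congr_ae (hw'.mono fun x hx => by
      simp only [hx, Literature.Analysis.FunctionSpaces.Torus.convect]
      exact real_inner_comm _ _)
  rw [e2, e3]
  ring

/-! ### The trigonometric-polynomial classes of coefficient vectors -/

/-- **`c ↦ T_M c` is continuous from the product topology to `L²`** (a linear map depending on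
finitely many coordinates, `‖T_M c‖ ≤ ∑_{|k| ≤ M} ‖c_k‖`). -/
theorem continuous_trigLp (M : ℕ) :
    Continuous fun c : (Fin 3 → ℤ) → EuclideanSpace ℂ (Fin 3) => (MemLp.toLp (realTrigPoly (freqBall (M)) (c)) (memLp_realTrigPoly (d := Fin 3)
          (freqBall (M)) (c) 2) : Lp (EuclideanSpace ℝ (Fin 3)) 2 (volume : Measure (UnitAddTorus (Fin 3)))) := by
  refine continuous_iff_continuousAt.2 fun c₀ => ?_
  rw [ContinuousAt, tendsto_iff_norm_sub_tendsto_zero]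
  have hb : ∀ c : (Fin 3 → ℤ) → EuclideanSpace ℂ (Fin 3),
      ‖(MemLp.toLp (realTrigPoly (freqBall (M)) (c)) (memLp_realTrigPoly (d := Fin 3) (freqBall (M)) (c) 2) : Lp (EuclideanSpace ℝ (Fin 3)) 2 (volume
            : Measure (UnitAddTorus (Fin 3)))) - (MemLp.toLp (realTrigPoly (freqBall (M)) (c₀)) (memLp_realTrigPoly (d := Fin 3) (freqBall (M)) (c₀)
            2) : Lp (EuclideanSpace ℝ (Fin 3)) 2 (volume : Measure (UnitAddTorus (Fin 3))))‖ ≤ ∑ k ∈ freqBall M, ‖c k - c₀ k‖ := fun c => by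
    rw [← MemLp.toLp_sub, Lp.norm_toLp, ← realTrigPoly_sub]
    have h := eLpNorm_le_of_ae_bound (μ := (volume : Measure (UnitAddTorus (Fin 3)))) (p := 2)
      (f := realTrigPoly (freqBall M) (c - c₀)) (C := ∑ k ∈ freqBall M, ‖c k - c₀ k‖)
      (ae_of_all _ fun x => (norm_realTrigPoly_apply_le _ _ x).trans_eq (by simp only [Pi.sub_apply]))
    rw [measure_univ, ENNReal.one_rpow, one_mul] at h
    exact ENNReal.toReal_le_of_le_ofReal (Finset.sum_nonneg fun k _ => norm_nonneg _) h
  have hlim : Tendsto (fun c : (Fin 3 → ℤ) → EuclideanSpace ℂ (Fin 3) => ∑ k ∈ freqBall M, ‖c k - c₀ k‖)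
      (𝓝 c₀) (𝓝 0) := by
    have hc : Continuous fun c : (Fin 3 → ℤ) → EuclideanSpace ℂ (Fin 3) => ∑ k ∈ freqBall M, ‖c k - c₀ k‖ :=
      continuous_finsetSum _ fun k _ => ((continuous_apply k).sub continuous_const).norm
    simpa using hc.tendsto c₀
  exact squeeze_zero_norm' (Eventually.of_forall fun c => by rw [norm_norm]; exact hb c) hlim

/-- **`T_M 𝓕w → [w]` in `L²`** for `w ∈ L²` (`T_M 𝓕w` is the class of the Fourier truncation
`P_M w`, `tendsto_toLp_fourierTruncate`). -/
theorem tendsto_trigLp_mFourierCoeff {w : UnitAddTorus (Fin 3) → EuclideanSpace ℝ (Fin 3)} (hw : MemLp w 2 volume) :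
    Tendsto (fun M : ℕ => (MemLp.toLp (realTrigPoly (freqBall (M)) (fun k => mFourierCoeff (EuclideanSpace.complexify ∘ w) k)) (memLp_realTrigPoly (d
          := Fin 3) (freqBall (M)) (fun k => mFourierCoeff (EuclideanSpace.complexify ∘ w) k) 2) : Lp (EuclideanSpace ℝ (Fin 3)) 2 (volume : Measure
          (UnitAddTorus (Fin 3))))) atTop
      (𝓝 (hw.toLp w)) := by
  have hae : (EuclideanSpace.complexify ∘ ((hw.toLp w : Lp (EuclideanSpace ℝ (Fin 3)) 2 (volume : Measure (UnitAddTorus (Fin 3)))) : UnitAddTorus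
        (Fin 3) → EuclideanSpace ℝ (Fin 3))) =ᵐ[volume]
      (EuclideanSpace.complexify ∘ w) := hw.coeFn_toLp.mono fun x hx => by simp only [Function.comp_apply, hx]
  refine (tendsto_toLp_fourierTruncate (hw.toLp w)).congr fun M => Lp.ext ?_
  filter_upwards [coeFn_toLp_fourierTruncate M (hw.toLp w),
    MemLp.coeFn_toLp (memLp_realTrigPoly (d := Fin 3) (freqBall M)
      (fun k => mFourierCoeff (EuclideanSpace.complexify ∘ w) k) 2)] with x h1 h2
  rw [h1, h2, fourierTruncate_eq]
  exact congrFun (realTrigPoly_congr fun k _ => mFourierCoeff_congr_ae hae k) x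

/-- **Bessel for the classes**: `‖T_M 𝓕w‖² ≤ ∫ ‖w‖²` for `w ∈ L²`. -/
theorem norm_trigLp_sq_le {w : UnitAddTorus (Fin 3) → EuclideanSpace ℝ (Fin 3)} (hw : MemLp w 2 volume) (M : ℕ) :
    ‖(MemLp.toLp (realTrigPoly (freqBall (M)) (fun k => mFourierCoeff (EuclideanSpace.complexify ∘ w) k)) (memLp_realTrigPoly (d := Fin 3) (freqBall
          (M)) (fun k => mFourierCoeff (EuclideanSpace.complexify ∘ w) k) 2) : Lp (EuclideanSpace ℝ (Fin 3)) 2 (volume : Measure (UnitAddTorus (Fin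
          3))))‖ ^ 2 ≤ ∫ x, ‖w x‖ ^ 2 := by
  rw [← integral_norm_sq_coe_eq]
  calc ∫ x, ‖(((MemLp.toLp (realTrigPoly (freqBall (M)) (fun k => mFourierCoeff (EuclideanSpace.complexify ∘ w) k)) (memLp_realTrigPoly (d := Fin 3)
        (freqBall (M)) (fun k => mFourierCoeff (EuclideanSpace.complexify ∘ w) k) 2) : Lp (EuclideanSpace ℝ (Fin 3)) 2 (volume : Measure
        (UnitAddTorus (Fin 3)))) : Lp (EuclideanSpace ℝ (Fin 3)) 2 (volume : Measure (UnitAddTorus (Fin 3)))) :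
          UnitAddTorus (Fin 3) → EuclideanSpace ℝ (Fin 3)) x‖ ^ 2
      = ∫ x, ‖fourierTruncate M w x‖ ^ 2 := by
        refine integral_congr_ae ?_
        filter_upwards [MemLp.coeFn_toLp (memLp_realTrigPoly (d := Fin 3) (freqBall M)
          (fun k => mFourierCoeff (EuclideanSpace.complexify ∘ w) k) 2)] with x hx
        rw [hx, fourierTruncate_eq]
    _ ≤ ∫ x, ‖w x‖ ^ 2 := integral_norm_sq_fourierTruncate_le hw M

/-! ### The cylindrical approximants of the tested generator -/

/-- **The cylindrical approximants are continuous** (in the product topology of the coefficient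
space): `c ↦ (−B) ∨ (B ∧ ⟨F(T_M c), a⟩)`. -/
theorem continuous_cutoffGen (ha : IsSmooth a) (M : ℕ) (B : ℝ) :
    Continuous fun c : (Fin 3 → ℤ) → EuclideanSpace ℂ (Fin 3) => max (-B) (min B ((∫ x, ⟪f x, a x⟫_ℝ) + ν * (∫ x, ⟪((((MemLp.toLp (realTrigPoly
          (freqBall (M)) (c)) (memLp_realTrigPoly (d := Fin 3) (freqBall (M)) (c) 2) : Lp (EuclideanSpace ℝ (Fin 3)) 2 (volume : Measure
          (UnitAddTorus (Fin 3))))) : Lp (EuclideanSpace ℝ (Fin 3)) 2 (volume : Measure (UnitAddTorus (Fin 3)))) : UnitAddTorus (Fin 3) →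
          EuclideanSpace ℝ (Fin 3)) x, laplacian a x⟫_ℝ) + inertialPairing (((MemLp.toLp (realTrigPoly (freqBall (M)) (c)) (memLp_realTrigPoly (d :=
          Fin 3) (freqBall (M)) (c) 2) : Lp (EuclideanSpace ℝ (Fin 3)) 2 (volume : Measure (UnitAddTorus (Fin 3))))) : Lp (EuclideanSpace ℝ (Fin 3))
          2 (volume : Measure (UnitAddTorus (Fin 3)))) a)) := by
  have h : Continuous fun c : (Fin 3 → ℤ) → EuclideanSpace ℂ (Fin 3) => ((∫ x, ⟪f x, a x⟫_ℝ) + ν * (∫ x, ⟪((((MemLp.toLp (realTrigPoly (freqBall (M))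
        (c)) (memLp_realTrigPoly (d := Fin 3) (freqBall (M)) (c) 2) : Lp (EuclideanSpace ℝ (Fin 3)) 2 (volume : Measure (UnitAddTorus (Fin 3))))) :
        Lp (EuclideanSpace ℝ (Fin 3)) 2 (volume : Measure (UnitAddTorus (Fin 3)))) : UnitAddTorus (Fin 3) → EuclideanSpace ℝ (Fin 3)) x, laplacian a
        x⟫_ℝ) + inertialPairing (((MemLp.toLp (realTrigPoly (freqBall (M)) (c)) (memLp_realTrigPoly (d := Fin 3) (freqBall (M)) (c) 2) : Lp
        (EuclideanSpace ℝ (Fin 3)) 2 (volume : Measure (UnitAddTorus (Fin 3))))) : Lp (EuclideanSpace ℝ (Fin 3)) 2 (volume : Measure (UnitAddTorus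
        (Fin 3)))) a) :=
    (continuous_gen (ν := ν) (f := f) ha).comp (continuous_trigLp M)
  exact continuous_const.max (continuous_const.min h)

/-- **The cutoff is inactive along fields of energy at most `R²`**: if `∫ ‖w‖² ≤ R²` and
`|⟨F(U), a⟩| ≤ K(1 + ‖U‖²)` on `L²`, then with `B = K (1 + R²)` the approximant at `𝓕w` is
`⟨F(T_M 𝓕w), a⟩` itself. -/
theorem cutoffGen_mFourierCoeff_eq {K : ℝ} (hK : ∀ U : Lp (EuclideanSpace ℝ (Fin 3)) 2 (volume : Measure (UnitAddTorus (Fin 3))), |((∫ x, ⟪f x, a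
      x⟫_ℝ) + ν * (∫ x, ⟪(((U) : Lp (EuclideanSpace ℝ (Fin 3)) 2 (volume : Measure (UnitAddTorus (Fin 3)))) : UnitAddTorus (Fin 3) → EuclideanSpace ℝ
      (Fin 3)) x, laplacian a x⟫_ℝ) + inertialPairing ((U) : Lp (EuclideanSpace ℝ (Fin 3)) 2 (volume : Measure (UnitAddTorus (Fin 3)))) a)| ≤ K * (1
      + ‖U‖ ^ 2)) (hK0 : 0 ≤ K)
    {w : UnitAddTorus (Fin 3) → EuclideanSpace ℝ (Fin 3)} (hw : MemLp w 2 volume) (hwR : ∫ x, ‖w x‖ ^ 2 ≤ R ^ 2)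
    (M : ℕ) :
    max (-(K * (1 + R ^ 2))) (min (K * (1 + R ^ 2))
      ((∫ x, ⟪f x, a x⟫_ℝ) + ν * (∫ x, ⟪((((MemLp.toLp (realTrigPoly (freqBall (M)) (fun k => mFourierCoeff (EuclideanSpace.complexify ∘ w) k))
            (memLp_realTrigPoly (d := Fin 3) (freqBall (M)) (fun k => mFourierCoeff (EuclideanSpace.complexify ∘ w) k) 2) : Lp (EuclideanSpace ℝ (Fin
            3)) 2 (volume : Measure (UnitAddTorus (Fin 3))))) : Lp (EuclideanSpace ℝ (Fin 3)) 2 (volume : Measure (UnitAddTorus (Fin 3)))) :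
            UnitAddTorus (Fin 3) → EuclideanSpace ℝ (Fin 3)) x, laplacian a x⟫_ℝ) + inertialPairing (((MemLp.toLp (realTrigPoly (freqBall (M)) (fun k
            => mFourierCoeff (EuclideanSpace.complexify ∘ w) k)) (memLp_realTrigPoly (d := Fin 3) (freqBall (M)) (fun k => mFourierCoeff
            (EuclideanSpace.complexify ∘ w) k) 2) : Lp (EuclideanSpace ℝ (Fin 3)) 2 (volume : Measure (UnitAddTorus (Fin 3))))) : Lp (EuclideanSpace
            ℝ (Fin 3)) 2 (volume : Measure (UnitAddTorus (Fin 3)))) a)) =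
      ((∫ x, ⟪f x, a x⟫_ℝ) + ν * (∫ x, ⟪((((MemLp.toLp (realTrigPoly (freqBall (M)) (fun k => mFourierCoeff (EuclideanSpace.complexify ∘ w) k))
            (memLp_realTrigPoly (d := Fin 3) (freqBall (M)) (fun k => mFourierCoeff (EuclideanSpace.complexify ∘ w) k) 2) : Lp (EuclideanSpace ℝ (Fin
            3)) 2 (volume : Measure (UnitAddTorus (Fin 3))))) : Lp (EuclideanSpace ℝ (Fin 3)) 2 (volume : Measure (UnitAddTorus (Fin 3)))) :
            UnitAddTorus (Fin 3) → EuclideanSpace ℝ (Fin 3)) x, laplacian a x⟫_ℝ) + inertialPairing (((MemLp.toLp (realTrigPoly (freqBall (M)) (fun k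
            => mFourierCoeff (EuclideanSpace.complexify ∘ w) k)) (memLp_realTrigPoly (d := Fin 3) (freqBall (M)) (fun k => mFourierCoeff
            (EuclideanSpace.complexify ∘ w) k) 2) : Lp (EuclideanSpace ℝ (Fin 3)) 2 (volume : Measure (UnitAddTorus (Fin 3))))) : Lp (EuclideanSpace
            ℝ (Fin 3)) 2 (volume : Measure (UnitAddTorus (Fin 3)))) a) := by
  refine max_neg_min_eq_self ((hK _).trans (mul_le_mul_of_nonneg_left ?_ hK0))
  linarith [norm_trigLp_sq_le hw M]

/-- **Tools stub (to be registered as `stub_augLimitDriftTools`): the cylindrical approximants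
of the tested generator.** For a smooth test mode `a`, `f ∈ L²` and `R`, there are a constant
`B` and, for every `M`, a bounded continuous cylindrical function `c_M` of the coefficients
(`|c_M| ≤ B`) such that along every `L²` field `w` of energy `∫‖w‖² ≤ R²` the values `c_M(𝓕w)`
converge, as `M → ∞`, to the flux `∫ (⟪w, (w·∇)a⟫ + ν⟪w, Δa⟫ + ⟪f, a⟫)`, and on `H` (fields
`u` with `‖u‖ ≤ R`) to `nsGeneratorPairing ν f u a`. -/
theorem stub_augLimitDriftTools {a : UnitAddTorus (Fin 3) → EuclideanSpace ℝ (Fin 3)} (hf : MemLp f 2 volume) (ha : IsSmooth a) (R : ℝ) :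
    ∃ (B : ℝ) (c : ℕ → ((Fin 3 → ℤ) → EuclideanSpace ℂ (Fin 3)) → ℝ),
      (∀ M, Continuous (c M)) ∧ (∀ M z, |c M z| ≤ B) ∧
      (∀ w : UnitAddTorus (Fin 3) → EuclideanSpace ℝ (Fin 3), MemLp w 2 volume → ∫ x, ‖w x‖ ^ 2 ≤ R ^ 2 →
        Tendsto (fun M => c M fun k => mFourierCoeff (EuclideanSpace.complexify ∘ w) k) atTop
          (𝓝 (∫ x, (⟪w x, convect w a x⟫_ℝ + ν * ⟪w x, laplacian a x⟫_ℝ + ⟪f x, a x⟫_ℝ)))) ∧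
      (∀ u : Torus.energySpace (Fin 3), ‖u‖ ≤ R →
        Tendsto (fun M => c M fun k => mFourierCoeff (EuclideanSpace.complexify ∘
          (u.1 : UnitAddTorus (Fin 3) → EuclideanSpace ℝ (Fin 3))) k) atTop (𝓝 (nsGeneratorPairing ν f u a))) := by
  obtain ⟨K, hK0, hK⟩ := exists_abs_gen_le ν f ha
  have hB0 : 0 ≤ K * (1 + R ^ 2) := by positivity
  refine ⟨K * (1 + R ^ 2), fun M z => max (-(K * (1 + R ^ 2))) (min (K * (1 + R ^ 2)) ((∫ x, ⟪f x, a x⟫_ℝ) + ν * (∫ x, ⟪(((MemLp.toLp (realTrigPoly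
        (freqBall (M)) (z)) (memLp_realTrigPoly (d := Fin 3) (freqBall (M)) (z) 2) : Lp (EuclideanSpace ℝ (Fin 3)) 2 (volume : Measure (UnitAddTorus
        (Fin 3)))) : Lp (EuclideanSpace ℝ (Fin 3)) 2 (volume : Measure (UnitAddTorus (Fin 3)))) : UnitAddTorus (Fin 3) → EuclideanSpace ℝ (Fin 3)) x,
        laplacian a x⟫_ℝ) + inertialPairing ((MemLp.toLp (realTrigPoly (freqBall (M)) (z)) (memLp_realTrigPoly (d := Fin 3) (freqBall (M)) (z) 2) :
        Lp (EuclideanSpace ℝ (Fin 3)) 2 (volume : Measure (UnitAddTorus (Fin 3)))) : Lp (EuclideanSpace ℝ (Fin 3)) 2 (volume : Measure (UnitAddTorus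
        (Fin 3)))) a)),
    fun M => continuous_cutoffGen ha M _, fun M z => abs_max_neg_min_le hB0 _, fun w hw hwR => ?_, fun u huR => ?_⟩
  · have h : (fun M : ℕ => max (-(K * (1 + R ^ 2))) (min (K * (1 + R ^ 2))
        ((∫ x, ⟪f x, a x⟫_ℝ) + ν * (∫ x, ⟪(((MemLp.toLp (realTrigPoly (freqBall (M)) (fun k => mFourierCoeff (EuclideanSpace.complexify ∘ w) k))
              (memLp_realTrigPoly (d := Fin 3) (freqBall (M)) (fun k => mFourierCoeff (EuclideanSpace.complexify ∘ w) k) 2) : Lp (EuclideanSpace ℝ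
              (Fin 3)) 2 (volume : Measure (UnitAddTorus (Fin 3)))) : Lp (EuclideanSpace ℝ (Fin 3)) 2 (volume : Measure (UnitAddTorus (Fin 3)))) :
              UnitAddTorus (Fin 3) → EuclideanSpace ℝ (Fin 3)) x, laplacian a x⟫_ℝ) + inertialPairing ((MemLp.toLp (realTrigPoly (freqBall (M)) (fun
              k => mFourierCoeff (EuclideanSpace.complexify ∘ w) k)) (memLp_realTrigPoly (d := Fin 3) (freqBall (M)) (fun k => mFourierCoeff
              (EuclideanSpace.complexify ∘ w) k) 2) : Lp (EuclideanSpace ℝ (Fin 3)) 2 (volume : Measure (UnitAddTorus (Fin 3)))) : Lp (EuclideanSpace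
              ℝ (Fin 3)) 2 (volume : Measure (UnitAddTorus (Fin 3)))) a))) =
        fun M : ℕ => ((∫ x, ⟪f x, a x⟫_ℝ) + ν * (∫ x, ⟪(((MemLp.toLp (realTrigPoly (freqBall (M)) (fun k => mFourierCoeff (EuclideanSpace.complexify
              ∘ w) k)) (memLp_realTrigPoly (d := Fin 3) (freqBall (M)) (fun k => mFourierCoeff (EuclideanSpace.complexify ∘ w) k) 2) : Lp
              (EuclideanSpace ℝ (Fin 3)) 2 (volume : Measure (UnitAddTorus (Fin 3)))) : Lp (EuclideanSpace ℝ (Fin 3)) 2 (volume : Measure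
              (UnitAddTorus (Fin 3)))) : UnitAddTorus (Fin 3) → EuclideanSpace ℝ (Fin 3)) x, laplacian a x⟫_ℝ) + inertialPairing ((MemLp.toLp
              (realTrigPoly (freqBall (M)) (fun k => mFourierCoeff (EuclideanSpace.complexify ∘ w) k)) (memLp_realTrigPoly (d := Fin 3) (freqBall
              (M)) (fun k => mFourierCoeff (EuclideanSpace.complexify ∘ w) k) 2) : Lp (EuclideanSpace ℝ (Fin 3)) 2 (volume : Measure (UnitAddTorus
              (Fin 3)))) : Lp (EuclideanSpace ℝ (Fin 3)) 2 (volume : Measure (UnitAddTorus (Fin 3)))) a) :=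
      funext fun M => cutoffGen_mFourierCoeff_eq hK hK0 hw hwR M
    rw [h, ← gen_toLp_eq_flux hf ha hw]
    exact ((continuous_gen (ν := ν) (f := f) ha).tendsto _).comp (tendsto_trigLp_mFourierCoeff hw)
  · have hu2 : MemLp ((u.1 : Lp (EuclideanSpace ℝ (Fin 3)) 2 (volume : Measure (UnitAddTorus (Fin 3)))) : UnitAddTorus (Fin 3) → EuclideanSpace ℝ
        (Fin 3)) 2 volume := Lp.memLp _
    have huR' : ∫ x, ‖((u.1 : Lp (EuclideanSpace ℝ (Fin 3)) 2 (volume : Measure (UnitAddTorus (Fin 3)))) : UnitAddTorus (Fin 3) → EuclideanSpace ℝ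
          (Fin 3)) x‖ ^ 2 ≤ R ^ 2 := by
      rw [integral_norm_sq_coe_eq]
      have h0 : 0 ≤ ‖u‖ := norm_nonneg u
      have : ‖(u.1 : Lp (EuclideanSpace ℝ (Fin 3)) 2 (volume : Measure (UnitAddTorus (Fin 3))))‖ = ‖u‖ := rfl
      rw [this]
      nlinarith
    have h : (fun M : ℕ => max (-(K * (1 + R ^ 2))) (min (K * (1 + R ^ 2))
        ((∫ x, ⟪f x, a x⟫_ℝ) + ν * (∫ x, ⟪(((MemLp.toLp (realTrigPoly (freqBall (M)) (fun k => mFourierCoeff (EuclideanSpace.complexify ∘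
          ((u.1 : Lp (EuclideanSpace ℝ (Fin 3)) 2 (volume : Measure (UnitAddTorus (Fin 3)))) : UnitAddTorus (Fin 3) → EuclideanSpace ℝ (Fin 3))) k))
                (memLp_realTrigPoly (d := Fin 3) (freqBall (M)) (fun k => mFourierCoeff (EuclideanSpace.complexify ∘
          ((u.1 : Lp (EuclideanSpace ℝ (Fin 3)) 2 (volume : Measure (UnitAddTorus (Fin 3)))) : UnitAddTorus (Fin 3) → EuclideanSpace ℝ (Fin 3))) k)
                2) : Lp (EuclideanSpace ℝ (Fin 3)) 2 (volume : Measure (UnitAddTorus (Fin 3)))) : Lp (EuclideanSpace ℝ (Fin 3)) 2 (volume : Measure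
                (UnitAddTorus (Fin 3)))) : UnitAddTorus (Fin 3) → EuclideanSpace ℝ (Fin 3)) x, laplacian a x⟫_ℝ) + inertialPairing ((MemLp.toLp
                (realTrigPoly (freqBall (M)) (fun k => mFourierCoeff (EuclideanSpace.complexify ∘
          ((u.1 : Lp (EuclideanSpace ℝ (Fin 3)) 2 (volume : Measure (UnitAddTorus (Fin 3)))) : UnitAddTorus (Fin 3) → EuclideanSpace ℝ (Fin 3))) k))
                (memLp_realTrigPoly (d := Fin 3) (freqBall (M)) (fun k => mFourierCoeff (EuclideanSpace.complexify ∘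
          ((u.1 : Lp (EuclideanSpace ℝ (Fin 3)) 2 (volume : Measure (UnitAddTorus (Fin 3)))) : UnitAddTorus (Fin 3) → EuclideanSpace ℝ (Fin 3))) k)
                2) : Lp (EuclideanSpace ℝ (Fin 3)) 2 (volume : Measure (UnitAddTorus (Fin 3)))) : Lp (EuclideanSpace ℝ (Fin 3)) 2 (volume : Measure
                (UnitAddTorus (Fin 3)))) a))) =
        fun M : ℕ => ((∫ x, ⟪f x, a x⟫_ℝ) + ν * (∫ x, ⟪(((MemLp.toLp (realTrigPoly (freqBall (M)) (fun k => mFourierCoeff (EuclideanSpace.complexify ∘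
          ((u.1 : Lp (EuclideanSpace ℝ (Fin 3)) 2 (volume : Measure (UnitAddTorus (Fin 3)))) : UnitAddTorus (Fin 3) → EuclideanSpace ℝ (Fin 3))) k))
                (memLp_realTrigPoly (d := Fin 3) (freqBall (M)) (fun k => mFourierCoeff (EuclideanSpace.complexify ∘
          ((u.1 : Lp (EuclideanSpace ℝ (Fin 3)) 2 (volume : Measure (UnitAddTorus (Fin 3)))) : UnitAddTorus (Fin 3) → EuclideanSpace ℝ (Fin 3))) k)
                2) : Lp (EuclideanSpace ℝ (Fin 3)) 2 (volume : Measure (UnitAddTorus (Fin 3)))) : Lp (EuclideanSpace ℝ (Fin 3)) 2 (volume : Measure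
                (UnitAddTorus (Fin 3)))) : UnitAddTorus (Fin 3) → EuclideanSpace ℝ (Fin 3)) x, laplacian a x⟫_ℝ) + inertialPairing ((MemLp.toLp
                (realTrigPoly (freqBall (M)) (fun k => mFourierCoeff (EuclideanSpace.complexify ∘
          ((u.1 : Lp (EuclideanSpace ℝ (Fin 3)) 2 (volume : Measure (UnitAddTorus (Fin 3)))) : UnitAddTorus (Fin 3) → EuclideanSpace ℝ (Fin 3))) k))
                (memLp_realTrigPoly (d := Fin 3) (freqBall (M)) (fun k => mFourierCoeff (EuclideanSpace.complexify ∘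
          ((u.1 : Lp (EuclideanSpace ℝ (Fin 3)) 2 (volume : Measure (UnitAddTorus (Fin 3)))) : UnitAddTorus (Fin 3) → EuclideanSpace ℝ (Fin 3))) k)
                2) : Lp (EuclideanSpace ℝ (Fin 3)) 2 (volume : Measure (UnitAddTorus (Fin 3)))) : Lp (EuclideanSpace ℝ (Fin 3)) 2 (volume : Measure
                (UnitAddTorus (Fin 3)))) a) :=
      funext fun M => cutoffGen_mFourierCoeff_eq hK hK0 hu2 huR' M
    rw [h, ← gen_coe u]
    have h2 := ((continuous_gen (ν := ν) (f := f) ha).tendsto _).comp (tendsto_trigLp_mFourierCoeff hu2)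
    rwa [Lp.toLp_coeFn (u.1 : Lp (EuclideanSpace ℝ (Fin 3)) 2 (volume : Measure (UnitAddTorus (Fin 3)))) hu2] at h2

end Summit.AnomalousDissipation.AnomalousDissipation.Theorems.EnsembleRealization
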